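import Summits.BirchSwinnertonDyer.Rank1Residual.P2.CongruentNumberPairsAtTwoPrimeSevenModEight
import HarnessLib

/-!
# Sub-lane «bsd-p2»: the `ρ`-FREE DOORS at `2` for the congruent-number curves `E_n`, keyed to the
# parity statement U⁺ (Tian–Yuan–Zhang Thm 3.5 (2) WITHOUT `ρ`) — file 1: the rank-one datum from U⁺
# and DOOR A (classes `5`, `7`); file 2 (`…UPlusSix.lean`): DOOR B6 (class `6`) and DOOR C6 (Tian's 2014
# class-`6` family) — p2-lead T-92 / T-94 (T-92 PS), lit-1 recipe T1-M39

HONEST FRAMING (sub-lane «bsd-p2», run/shared/lean/b2b/bsd-rank1-residual/p2/, verbatim in every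
file): the target of record is the FULL Birch–Swinnerton-Dyer formula for EVERY analytic-rank `≤ 1`
`E/ℚ` at ALL primes INCLUDING `2`; the odd-prime class ledger is referee A's; the `2`-part is OPEN
(cells O1 = X5 ∖ CM and O12 = the CM corner) and under census by «bsd-p2». Census / instrument
output at `2` = EVIDENCE / conjecture items with held-out validation, NEVER a Literature fact;
certificates close PAIRS (one isogeny class, `p = 2`), never classes. This file asserts NO
arithmetic fact. WHAT IT DOES. The D-CN-6 doors (`P2/CongruentNumberPairsAtTwoRankOneGenus.lean`,
`…PrimeSevenModEight.lean` §0/§3) close a rank-one pair `(E_n, 2)`, `n ≡ 5, 7 (mod 8)`, from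
Tian–Yuan–Zhang 2017 Thm 1.2 AS PRINTED (`thm12_parity_of_scriptL'`) — which needs the index
`2^{ρ(n)} = [E_n(ℚ) : φ_n(A_n(ℚ)) + E_n[2]]` to be `1` (`hρ`, a φ̂-descent certificate per `n`), because
the printed hypothesis of Thm 1.2 / Thm 3.5 (2) is "`2^{−ρ(n)}𝓛(n)` even". The sub-lane's W2 programme
(p2-idea-2's note U⁺; kernel p2-monsky-lit, files `TianYuanZhang2017/GenusDescent*.lean`,
`UPlusOfGenusPointData.lean`) proves the `ρ`-FREE strengthening **U⁺**: for every square-free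
`n ≡ 5, 6, 7 (mod 8)` there is `L ∈ ℤ` with `L² = 𝓛(n)²` such that `2 ∣ L` forces `Σ₁(n)`, `Σ₂′(n)` even
(`n ≡ 5, 7`) resp. `Σ₂′(n)` even (`n ≡ 6`) — as the theorem `W2.uPlus_genusField_of (hTYZ) (hGZK)`
modulo p2-lit-1's DISPLAYED printed statements of TYZ §3 (`tyz_genusPointData`) and GZK. THIS FILE
types the doors that CONSUME U⁺, taking it as the HYPOTHESIS `hU` spelled in tree currency (the exact
conclusion of `W2.uPlus_genusField_of`, with `gK d` unfolded to `genusClassNumber (GenusField d)`), so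
that the discharge is BY NAME the day the composition lands (one-line corollaries, successor file) and
no door depends on which seat's theorem supplies it:
* §1 `𝓛(n)` ODD and the rank-one datum `ord_{s=1} L(E_n, s) = 1`,
  `L′(E_n,1) = 2^{2k(n)−2−a(n)}·L²·Ω(E_n)·Reg(E_n)` from `hU` + an odd genus sum (classes `5`, `7`:
  `Σ₁` odd or `Σ₂′` odd; class `6`: `Σ₂′` odd) — NO `ρ`, no L-value;
* §2 DOOR A (`n = p₁⋯p_k ≡ 5, 7 (mod 8)`): `hU`, `hGZK`, Monsky 1994 odd (`hM`) + the KERNEL-DECIDED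
  inputs of D-CN-6 (Legendre tables, Monsky kernel count `2` i.e. `s(n) = 1`, `Σ₁` odd or `Σ₂′` odd)
  ⟹ `ord = 1`, rank `1`, `Ш(E_n)[2^∞] = 0`, `BSD(E_n, 2)` — torsion (p323719) and Tamagawa (p324736)
  by lit-1's theorems, nothing per-curve displayed, NO `hρ`.
DOOR B6 (`n = 2p₁⋯p_k ≡ 6 (mod 8)`, Monsky's even matrix) and DOOR C6 (Tian's 2014 class-`6` family,
no GZK, no Monsky) are in the sibling `P2/CongruentNumberPairsAtTwoUPlusSix.lean`.
Until `W2.uPlus_genusField_of` is in the tree every theorem here is CONDITIONAL on `hU` (a hypothesis,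
not a fact of the tree); the sub-lane's reach counts for these doors (p2-monsky-x PRE-ARM: DOOR A
508 384 rows `< 3·10⁶`) are census EVIDENCE and not coverage. Per-pair statements in the OPEN cell
`openO12`; they close no class. Nothing booked; no mark moved. Unit `b2b-bsdres-p2-typer` GEN 5; NEW file.

References: [TianYuanZhang2017] Thm 1.2, Thm 3.5, §1 (1.1); [HeathBrown1994SelmerCongruentII]
Appendix (Monsky) p. 39; [SilvermanAEC2009] Thm X.4.2; [SilvermanATAEC1994] IV.9 Table 4.1; [Knapp1993]
Lemma 4.20; [Miller2011LMS] Def 1.1; HOME/p2/LEAD-OKS.md L1-65 / T-92 / T-94; HOME/p2/LIT-STATUS.md T1-M38.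
-/

noncomputable section

open scoped Classical

open Matrix Finset WeierstrassCurve NumberField Literature.NumberTheory.EllipticCurves
  Literature.NumberTheory.EllipticCurves.Rank1Residual
  Literature.NumberTheory.EllipticCurves.Rank1Residual.Typed
  Literature.NumberTheory.EllipticCurves.HeathBrown1994
  Literature.NumberTheory.EllipticCurves.TianYuanZhang2017
  Literature.NumberTheory.QuadraticFields.RedeiReichardt

set_option autoImplicit false

namespace Summit.BirchSwinnertonDyer.Rank1Residual.P2

/-! ## §1 From U⁺ and an odd genus sum: `𝓛(n)` odd, `ord_{s=1} L(E_n, s) = 1`, the `L′`-datum — no `ρ` -/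

section Datum

/-- **U⁺ ⟹ `𝓛(n)` odd, classes `5` and `7`.** Under the `ρ`-free parity statement U⁺ (hypothesis
`hU`, the conclusion of `W2.uPlus_genusField_of` in tree currency), square-free `n ≡ 5, 7 (mod 8)` with
`Σ₁(n)` odd or `Σ₂′(n)` odd (over `K_d = GenusField d`) has `𝓛(n)² = L²` with `L` ODD. (The `ρ`-free twin
of `exists_odd_scriptL_of_index_eq_one'`.) [cite: TianYuanZhang2017, Thm. 1.2 (chunk p0002 L112–L120); Thm. 3.5 (p0011 L94–L112)] -/
theorem exists_odd_scriptL_of_uPlus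
    (hU : ∀ (n : ℕ), Squarefree n → (n % 8 = 5 ∨ n % 8 = 6 ∨ n % 8 = 7) →
      ∃ L : ℤ, IsScriptL n L ∧
        ((n % 8 = 5 ∨ n % 8 = 7) → (2 : ℤ) ∣ L →
          Even (genusSum₁ n fun d => genusClassNumber (GenusField d)) ∧
          Even (genusSum₂' n fun d => genusClassNumber (GenusField d))) ∧
        (n % 8 = 6 → (2 : ℤ) ∣ L → Even (genusSum₂' n fun d => genusClassNumber (GenusField d))))
    {n : ℕ} (hsq : Squarefree n) (h8 : n % 8 = 5 ∨ n % 8 = 7)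
    (hodd : Odd (genusSum₁ n fun d => genusClassNumber (GenusField d)) ∨
      Odd (genusSum₂' n fun d => genusClassNumber (GenusField d))) :
    ∃ L : ℤ, Odd L ∧ IsScriptL n L := by
  obtain ⟨L, hL, h57, -⟩ := hU n hsq (by omega)
  refine ⟨L, ?_, hL⟩
  by_contra hne
  obtain ⟨e₁, e₂⟩ := h57 h8 (Int.not_odd_iff_even.mp hne).two_dvd
  rcases hodd with ho | ho
  · exact (Nat.not_even_iff_odd.mpr ho) e₁
  · exact (Nat.not_even_iff_odd.mpr ho) e₂

/-- **U⁺ ⟹ `𝓛(n)` odd, class `6`**: square-free `n ≡ 6 (mod 8)` with `Σ₂′(n)` odd has `𝓛(n)² = L²`,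
`L` ODD. (The `ρ`-free twin of `exists_odd_scriptL_of_index_eq_one_six'`.)
[cite: TianYuanZhang2017, Thm. 1.2 (chunk p0002 L121–L127); Thm. 3.5 (p0011 L94–L112)] -/
theorem exists_odd_scriptL_of_uPlus_six
    (hU : ∀ (n : ℕ), Squarefree n → (n % 8 = 5 ∨ n % 8 = 6 ∨ n % 8 = 7) →
      ∃ L : ℤ, IsScriptL n L ∧
        ((n % 8 = 5 ∨ n % 8 = 7) → (2 : ℤ) ∣ L →
          Even (genusSum₁ n fun d => genusClassNumber (GenusField d)) ∧
          Even (genusSum₂' n fun d => genusClassNumber (GenusField d))) ∧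
        (n % 8 = 6 → (2 : ℤ) ∣ L → Even (genusSum₂' n fun d => genusClassNumber (GenusField d))))
    {n : ℕ} (hsq : Squarefree n) (h8 : n % 8 = 6)
    (hodd : Odd (genusSum₂' n fun d => genusClassNumber (GenusField d))) :
    ∃ L : ℤ, Odd L ∧ IsScriptL n L := by
  obtain ⟨L, hL, -, h6⟩ := hU n hsq (by omega)
  refine ⟨L, ?_, hL⟩
  by_contra hne
  exact (Nat.not_even_iff_odd.mpr hodd) (h6 h8 (Int.not_odd_iff_even.mp hne).two_dvd)

/-- **The rank-one datum from U⁺, classes `5` and `7`** (`ρ`-free twin of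
`rankOneDatum_of_index_eq_one'`): `ord_{s=1} L(E_n, s) = 1` and
`L′(E_n, 1) = 2^{2k(n)−2−a(n)} · L² · Ω(E_n) · Reg(E_n)` with `L` odd — no L-value computed, no `ρ`.
[cite: TianYuanZhang2017, Thm. 1.2 and §1 (1.1); Thm. 3.5 (p0011 L94–L112)] -/
theorem rankOneDatum_of_uPlus
    (hU : ∀ (n : ℕ), Squarefree n → (n % 8 = 5 ∨ n % 8 = 6 ∨ n % 8 = 7) →
      ∃ L : ℤ, IsScriptL n L ∧
        ((n % 8 = 5 ∨ n % 8 = 7) → (2 : ℤ) ∣ L →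
          Even (genusSum₁ n fun d => genusClassNumber (GenusField d)) ∧
          Even (genusSum₂' n fun d => genusClassNumber (GenusField d))) ∧
        (n % 8 = 6 → (2 : ℤ) ∣ L → Even (genusSum₂' n fun d => genusClassNumber (GenusField d))))
    {n : ℕ} (hsq : Squarefree n) (h8 : n % 8 = 5 ∨ n % 8 = 7)
    (hodd : Odd (genusSum₁ n fun d => genusClassNumber (GenusField d)) ∨
      Odd (genusSum₂' n fun d => genusClassNumber (GenusField d))) :
    ∃ L : ℤ, Odd L ∧ (congruentNumberCurve n).analyticRank = 1 ∧
      deriv (congruentNumberCurve n).entireLFunction 1 =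
        (2 : ℂ) ^ twoExponent n * (L : ℂ) ^ 2 *
          ((congruentNumberCurve n).realPeriodRat : ℂ) * ((congruentNumberCurve n).regulator : ℂ) := by
  obtain ⟨L, hLodd, hL⟩ := exists_odd_scriptL_of_uPlus hU hsq h8 hodd
  have hL0 : L ≠ 0 := fun h => by simp [h] at hLodd
  have hr := analyticRank_congruentNumberCurve_eq_one_of_isScriptL hsq (by omega) hL hL0
  refine ⟨L, hLodd, hr, ?_⟩
  rw [← (leadingLCoeff_eq_deriv_of_analyticRank_eq_one hr).1]
  exact leadingLCoeff_congruentNumberCurve_eq_of_isScriptL (Nat.pos_of_ne_zero hsq.ne_zero) hr hL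

/-- **The rank-one datum from U⁺, class `6`** (`ρ`-free twin of `rankOneDatum_of_index_eq_one_six'`).
[cite: TianYuanZhang2017, Thm. 1.2 and §1 (1.1); Thm. 3.5 (p0011 L94–L112)] -/
theorem rankOneDatum_of_uPlus_six
    (hU : ∀ (n : ℕ), Squarefree n → (n % 8 = 5 ∨ n % 8 = 6 ∨ n % 8 = 7) →
      ∃ L : ℤ, IsScriptL n L ∧
        ((n % 8 = 5 ∨ n % 8 = 7) → (2 : ℤ) ∣ L →
          Even (genusSum₁ n fun d => genusClassNumber (GenusField d)) ∧
          Even (genusSum₂' n fun d => genusClassNumber (GenusField d))) ∧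
        (n % 8 = 6 → (2 : ℤ) ∣ L → Even (genusSum₂' n fun d => genusClassNumber (GenusField d))))
    {n : ℕ} (hsq : Squarefree n) (h8 : n % 8 = 6)
    (hodd : Odd (genusSum₂' n fun d => genusClassNumber (GenusField d))) :
    ∃ L : ℤ, Odd L ∧ (congruentNumberCurve n).analyticRank = 1 ∧
      deriv (congruentNumberCurve n).entireLFunction 1 =
        (2 : ℂ) ^ twoExponent n * (L : ℂ) ^ 2 *
          ((congruentNumberCurve n).realPeriodRat : ℂ) * ((congruentNumberCurve n).regulator : ℂ) := by
  obtain ⟨L, hLodd, hL⟩ := exists_odd_scriptL_of_uPlus_six hU hsq h8 hodd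
  have hL0 : L ≠ 0 := fun h => by simp [h] at hLodd
  have hr := analyticRank_congruentNumberCurve_eq_one_of_isScriptL hsq (by omega) hL hL0
  refine ⟨L, hLodd, hr, ?_⟩
  rw [← (leadingLCoeff_eq_deriv_of_analyticRank_eq_one hr).1]
  exact leadingLCoeff_congruentNumberCurve_eq_of_isScriptL (Nat.pos_of_ne_zero hsq.ne_zero) hr hL

end Datum

/-! ## §2 DOOR A: `n = p₁⋯p_k ≡ 5, 7 (mod 8)`, `s(n) = 1`, `Σ₁` odd or `Σ₂′` odd — no `ρ`, nothing displayed -/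

section DoorA

variable {k : ℕ} (p : Fin k → ℕ)

/-- **DOOR A (`ρ`-FREE D-CN-6).** `n = p₁⋯p_k` (distinct odd primes), `n ≡ 5, 7 (mod 8)`; hypothesis
U⁺ (`hU`); named facts `hGZK` (Gross–Zagier–Kolyvagin), `hM` (Monsky 1994, odd case); KERNEL-DECIDED
inputs: `s(n) = 1` by the table route with a counted kernel (`hker`), `Σ₁(n)` odd or `Σ₂′(n)` odd over
`GenusField` (`hgen`; one `decide` through `P2/CongruentNumberPairsAtTwoGenusRedei.lean`). THEN
`ord_{s=1} L(E_n, s) = 1`, rank `E_n(ℚ) = 1`, `Ш(E_n)[2^∞] = 0` and `BSD(E_n, 2)` — with NO index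
hypothesis `ρ(n) = 0`: `L′(E_n,1)/(Ω·Reg) = 2^{2k−3}·L²`, `L` odd (§1); `#Sel₂ = 8` and rank `1` give
`Ш[2] = 0`; `#E_n(ℚ)_tor = 4`, `∏c_ℓ = 2^{2k+1}` are lit-1's theorems. (Twin of
`bsdp_two_congruentNumberCurve_iff_of_genus'` / `…_of_genus''` with `h12`, `hρ` replaced by `hU`.)
[cite: TianYuanZhang2017, Thm. 1.2, Thm. 3.5 and §1 (1.1)]
[cite: HeathBrown1994SelmerCongruentII, Appendix (Monsky), typescript p. 39 L10–L33]
[cite: SilvermanAEC2009, Thm. X.4.2] [cite: Miller2011LMS, Def. 1.1 (arXiv:1010.2431 p. 3)] -/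
theorem rankOne_sha_bsdp_two_congruentNumberCurve_of_uPlus
    (hU : ∀ (n : ℕ), Squarefree n → (n % 8 = 5 ∨ n % 8 = 6 ∨ n % 8 = 7) →
      ∃ L : ℤ, IsScriptL n L ∧
        ((n % 8 = 5 ∨ n % 8 = 7) → (2 : ℤ) ∣ L →
          Even (genusSum₁ n fun d => genusClassNumber (GenusField d)) ∧
          Even (genusSum₂' n fun d => genusClassNumber (GenusField d))) ∧
        (n % 8 = 6 → (2 : ℤ) ∣ L → Even (genusSum₂' n fun d => genusClassNumber (GenusField d))))
    (hGZK : rank_eq_analyticRank_of_analyticRank_le_one) (hM : monsky_card_selmerGroup_two_odd)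
    (hp : ∀ i, (p i).Prime) (hodd : ∀ i, Odd (p i)) (hinj : Function.Injective p)
    {n : ℕ} (hn : ∏ i, p i = n) (h8 : n % 8 = 5 ∨ n % 8 = 7)
    (L : Fin k → Fin k → ZMod 2) (d2 dm2 : Fin k → ZMod 2)
    (hL : ∀ i j, addLegendreSym (p j) (p i) = L i j) (h2 : ∀ i, addLegendreSym 2 (p i) = d2 i)
    (hm2 : ∀ i, addLegendreSym (-2) (p i) = dm2 i)
    (hker : Fintype.card {v : Fin k ⊕ Fin k → ZMod 2 // Matrix.fromBlocks
        (Matrix.of (fun i j => if i = j then ∑ l ∈ Finset.univ.erase i, L i l else L i j) +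
          Matrix.diagonal d2) (Matrix.diagonal d2) (Matrix.diagonal d2)
        (Matrix.of (fun i j => if i = j then ∑ l ∈ Finset.univ.erase i, L i l else L i j) +
          Matrix.diagonal dm2) *ᵥ v = 0} = 2)
    (hgen : Odd (genusSum₁ n fun d => genusClassNumber (GenusField d)) ∨
      Odd (genusSum₂' n fun d => genusClassNumber (GenusField d))) :
    (congruentNumberCurve n).analyticRank = 1 ∧ (congruentNumberCurve n).mordellWeilRank = 1 ∧
      AddCommGroup.primaryComponent (congruentNumberCurve n).sha 2 = ⊥ ∧
      BSDp (congruentNumberCurve n) 2 := by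
  have hsq : Squarefree n := hn ▸ squarefree_prod_of_injective p hp hinj
  have hn0 : n ≠ 0 := hsq.ne_zero
  haveI := isElliptic_congruentNumberCurve hn0
  haveI : Fact (Nat.Prime 2) := ⟨Nat.prime_two⟩
  -- U⁺ + odd genus sum: `ord = 1`, `L′ = 2^e · 𝓛² · Ω · Reg` with `𝓛` odd — no `ρ`
  obtain ⟨Lz, hLodd, hr1, hderiv⟩ := rankOneDatum_of_uPlus hU hsq h8 hgen
  have hx : deriv (congruentNumberCurve n).entireLFunction 1 =
      (((2 : ℚ) ^ twoExponent n * (Lz : ℚ) ^ 2 : ℚ) : ℂ) *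
        ((congruentNumberCurve n).realPeriodRat : ℂ) * ((congruentNumberCurve n).regulator : ℂ) := by
    rw [hderiv]; push_cast; ring
  -- GZK: rank `1`; Monsky + counted kernel: `#Sel₂ = 8`; hence `Ш[2^∞] = 0`
  obtain ⟨hrank, -⟩ := hGZK (congruentNumberCurve n) (le_of_eq hr1)
  rw [hr1] at hrank
  have hs : monskySelmerRankOdd p = 1 :=
    monskySelmerRankOdd_eq_of_table p L d2 dm2 hL h2 hm2 (s := 1) (by rw [hker, pow_one])
  have hsel : Nat.card ((congruentNumberCurve n).selmerGroup 2) = 8 := by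
    subst hn
    rw [hM k p hp hodd hinj, hs]
    norm_num
  have hbot := primaryComponent_sha_two_eq_bot_of_card_selmerGroup_eq_eight hn0 hrank hsel
  refine ⟨hr1, hrank, hbot, ?_⟩
  rw [bsdp_two_iff_of_LDerivOverOmegaReg_of_sha_two_eq_bot_of_torsionOrder_eq_four
    (congruentNumberCurve n) hGZK hr1 hx hbot (torsionOrder_congruentNumberCurve hsq),
    padicValRat_two_zpow_mul_sq hLodd, tamagawaProduct_congruentNumberCurve_prod p hp hodd hinj hn,
    padicValNat.prime_pow, ← hn, twoExponent_prod_eq p hp hodd hinj]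
  push_cast
  omega

/-- **DOOR A, closed form: `BSD(E_n, 2)`** for `n = p₁⋯p_k ≡ 5, 7 (mod 8)` with Monsky kernel count `2`
and `Σ₁` odd or `Σ₂′` odd, modulo `hU` (U⁺), `hGZK`, `hM` and nothing else — the `ρ`-free twin of
`bsdp_two_congruentNumberCurve_of_genus''` (same binders minus `h12`, `hρ`, plus `hU`).
[cite: TianYuanZhang2017, Thm. 1.2, Thm. 3.5 and §1 (1.1)] [cite: Miller2011LMS, Def. 1.1 (arXiv:1010.2431 p. 3)] -/
theorem bsdp_two_congruentNumberCurve_of_uPlus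
    (hU : ∀ (n : ℕ), Squarefree n → (n % 8 = 5 ∨ n % 8 = 6 ∨ n % 8 = 7) →
      ∃ L : ℤ, IsScriptL n L ∧
        ((n % 8 = 5 ∨ n % 8 = 7) → (2 : ℤ) ∣ L →
          Even (genusSum₁ n fun d => genusClassNumber (GenusField d)) ∧
          Even (genusSum₂' n fun d => genusClassNumber (GenusField d))) ∧
        (n % 8 = 6 → (2 : ℤ) ∣ L → Even (genusSum₂' n fun d => genusClassNumber (GenusField d))))
    (hGZK : rank_eq_analyticRank_of_analyticRank_le_one) (hM : monsky_card_selmerGroup_two_odd)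
    (hp : ∀ i, (p i).Prime) (hodd : ∀ i, Odd (p i)) (hinj : Function.Injective p)
    {n : ℕ} (hn : ∏ i, p i = n) (h8 : n % 8 = 5 ∨ n % 8 = 7)
    (L : Fin k → Fin k → ZMod 2) (d2 dm2 : Fin k → ZMod 2)
    (hL : ∀ i j, addLegendreSym (p j) (p i) = L i j) (h2 : ∀ i, addLegendreSym 2 (p i) = d2 i)
    (hm2 : ∀ i, addLegendreSym (-2) (p i) = dm2 i)
    (hker : Fintype.card {v : Fin k ⊕ Fin k → ZMod 2 // Matrix.fromBlocks
        (Matrix.of (fun i j => if i = j then ∑ l ∈ Finset.univ.erase i, L i l else L i j) +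
          Matrix.diagonal d2) (Matrix.diagonal d2) (Matrix.diagonal d2)
        (Matrix.of (fun i j => if i = j then ∑ l ∈ Finset.univ.erase i, L i l else L i j) +
          Matrix.diagonal dm2) *ᵥ v = 0} = 2)
    (hgen : Odd (genusSum₁ n fun d => genusClassNumber (GenusField d)) ∨
      Odd (genusSum₂' n fun d => genusClassNumber (GenusField d))) :
    BSDp (congruentNumberCurve n) 2 :=
  (rankOne_sha_bsdp_two_congruentNumberCurve_of_uPlus p hU hGZK hM hp hodd hinj hn h8 L d2 dm2 hL h2
    hm2 hker hgen).2.2.2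

end DoorA

end Summit.BirchSwinnertonDyer.Rank1Residual.P2

end
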